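import Literature.NumberTheory.EllipticCurves.BDPAnticyclotomicPAdicLFunction
import HarnessLib

/-!
# The BDP / Castella interpolation property UP TO A NONZERO CONSTANT (`IsBDPLFunctionUpTo`)

A one-parameter relaxation of the characterising predicate `IsBDPLFunction`
(`BDPAnticyclotomicPAdicLFunction.lean`, Castella 2018 Thm. 3.1's display): `IsBDPLFunctionUpTo C ι 𝔭 κ γ f
Ω_K Ω_p L` asks that `L ∈ R₀⟦T⟧` take at `T = φ̂(γ) − 1` the value `C · ι⁻¹(display value) · Ω_p^{4n}`
for every unramified anticyclotomic `φ` of infinity type `(-n, n)`, `n > 0` — the SAME interpolation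
range and the SAME `φ`- and `n`-dependence as `IsBDPLFunction`, with one `φ`- and `n`-independent
constant `C ∈ ℂ_p` in front. `C = 1` is `IsBDPLFunction` (`isBDPLFunctionUpTo_one_iff`).

WHY (statement hygiene, cell `bsd-cn100`, plan seat g13 decision (iii), memo
`HOME/bsd-cn100-plan/routes-g13/DESIGN-LBexist-normalisation-g13.md`): the printed constructions carry
`φ`- and `n`-INDEPENDENT constants outside Castella's display — Castella–Hsieh 2018, Prop. 3.4 / Def. 3.5 /
Prop. 3.6 (arXiv:1505.08165 pp. 10–11): `ℒ_{𝔭,ψ}(f) = u · ℒ_𝔭(π, ψ)` with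
`u = 2^{#A(ψ)+3} · c · ε(f) · √D_K`, and `(4π)^{2n+1} (Im ϑ)^{2n}`, `u_K²` in the interpolation formula —
which are `p`-adic UNITS at the odd primes `p ∤ c·D_K` of the printed range (so absorbable into
`L ∈ R₀⟦T⟧`, `R₀^×`-ambiguity being immaterial to every consumer) but NOT at `p = 2`: AS TYPED (exact
display, `L ∈ R₀⟦T⟧`) an existence statement `∃ L, IsBDPLFunction …` at `p = 2` can fail for a
normalisation reason only (`ord₂` of the true constant `> 0`). For a CONVERSE theorem the honest
existence statement is `∃ C ≠ 0, ∃ L, IsBDPLFunctionUpTo C …`: the consumers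
(`𝓛(𝟙) ≠ 0 ⟹ log_ω P ≠ 0`, main-conjecture divisibilities up to powers of `p`) are insensitive to `C`.
`n`-th-power constants are absorbed by the free period `Ω_K`, and `φ(𝔞)`-monomials by Iwasawa-unit
factors `(1+T)^s`; what `C` does NOT absorb is a wrong SHAPE of the `φ`/`n`-dependence (not claimed).

Contents: `IsBDPLFunctionUpTo` (def, a characterising PREDICATE with parameters — not a construction,
not an existence claim, nothing asserted), `isBDPLFunctionUpTo_one_iff`, `IsBDPLFunction.upTo_one`,
`IsBDPLFunctionUpTo.hasValueAt`, `IsBDPLFunctionUpTo.eq_of_hasValueAt`. No instance, no notation, no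
named fact (net debt delta `0`).

References: [Castella2018] F. Castella, Camb. J. Math. 6 (2018), Thm. 3.1 (arXiv:1704.06608 p. 9).
[CastellaHsieh2018] F. Castella, M.-L. Hsieh, Math. Ann. 370 (2018), §3.3, Prop. 3.4, Def. 3.5,
Prop. 3.6 (arXiv:1505.08165 pp. 9–11). [BertoliniDarmonPrasanna2013] Duke Math. J. 162 (2013), Thm. 5.13.
-/

noncomputable section

open scoped MatrixGroups ModularForm Topology
open CongruenceSubgroup NumberField IsDedekindDomain Field
open Literature.NumberTheory.GaloisRepresentations
open Literature.NumberTheory.EllipticCurves.ModularForms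

namespace Literature.NumberTheory.EllipticCurves

universe u

section InterpolationUpTo

variable {K : Type u} [Field K] [NumberField K] {N : ℕ} {p : ℕ} [Fact p.Prime]

/-- **The BDP interpolation property UP TO A CONSTANT `C ∈ ℂ_p`** (Castella 2018, Thm. 3.1's display
with one `φ`-, `n`-independent constant in front): `L ∈ R₀⟦T⟧` takes at `T = φ̂(γ) - 1` the value
`C · ι⁻¹(Γ(n)Γ(n+1) · (1 - a_p p⁻¹ φ(𝔭) + ε_p φ(𝔭)²)² · L(f/K, φ, 1) / (π^{2n+1} Ω_K^{4n})) · Ω_p^{4n}`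
(`bdpInterpolationValue` transported along `ι⁻¹`, times `Ω_p^{4n}`, times `C`) for every Hecke character
`φ` of `K` unramified at all finite places and of infinity type `(-n, n)`, `n > 0` (tree convention
`HasInfinityType (fun _ ↦ n) (fun _ ↦ -n)`), and every `p`-adic avatar `r` of `φ` factoring through the
`ℤ_p`-quotient `κ` — word for word the body of `IsBDPLFunction` with the value multiplied by `C`.
`C = 1` is `IsBDPLFunction` (`isBDPLFunctionUpTo_one_iff`). Rationale: the constants
`2^{#A(ψ)+3} c ε(f) √D_K`, `u_K²`, `(4π)^{2n+1}(Im ϑ)^{2n}` of Castella–Hsieh 2018, Prop. 3.4 / 3.6 sit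
outside the display and are units only at odd `p ∤ c D_K`. A characterising PREDICATE; nothing asserted.
[cite: Castella2018, Thm. 3.1] [cite: CastellaHsieh2018, Prop. 3.4, Def. 3.5 and Prop. 3.6] -/
def IsBDPLFunctionUpTo (C : ℂ_[p]) (ι : PadicAlgCl p ≃+* ℂ) (𝔭 : HeightOneSpectrum (𝓞 K))
    (κ : ZpExtension K p) (γ : absoluteGaloisGroup K) (f : CuspForm (Gamma0 N) 2) (ΩK : ℂ)
    (Ωp : ℂ_[p]) (L : UnrSeries p) : Prop :=
  ∀ (φ : HeckeCharacter K) (n : ℕ), 0 < n → (∀ v : HeightOneSpectrum (𝓞 K), φ.IsUnramifiedAt v) →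
    φ.HasInfinityType (fun _ ↦ (n : ℤ)) (fun _ ↦ -(n : ℤ)) →
    ∀ r : FramedGaloisRep K (PadicAlgCl p) 1, IsPAdicAvatarOf ι φ r → FactorsThroughZp κ r →
      L.HasValueAt (avatarValueAt r γ - 1)
        (C * (((ι.symm (bdpInterpolationValue p f 𝔭 φ n ΩK) : PadicAlgCl p) : ℂ_[p]) *
          Ωp ^ (4 * n)))

variable {ι : PadicAlgCl p ≃+* ℂ} {𝔭 : HeightOneSpectrum (𝓞 K)} {κ : ZpExtension K p}
  {γ : absoluteGaloisGroup K} {f : CuspForm (Gamma0 N) 2} {ΩK : ℂ} {Ωp : ℂ_[p]} {L : UnrSeries p}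
  {C : ℂ_[p]}

/-- **`C = 1` is Castella's exact display**: `IsBDPLFunctionUpTo 1 … ↔ IsBDPLFunction …`.
[cite: Castella2018, Thm. 3.1] -/
theorem isBDPLFunctionUpTo_one_iff :
    IsBDPLFunctionUpTo 1 ι 𝔭 κ γ f ΩK Ωp L ↔ IsBDPLFunction ι 𝔭 κ γ f ΩK Ωp L := by
  simp only [IsBDPLFunctionUpTo, IsBDPLFunction, one_mul]

/-- An exact BDP element is a BDP element up to the constant `1`. [cite: Castella2018, Thm. 3.1] -/
theorem IsBDPLFunction.upTo_one (h : IsBDPLFunction ι 𝔭 κ γ f ΩK Ωp L) :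
    IsBDPLFunctionUpTo 1 ι 𝔭 κ γ f ΩK Ωp L :=
  isBDPLFunctionUpTo_one_iff.mpr h

/-- Unfolding `IsBDPLFunctionUpTo` at one character: the prescribed value at `T = φ̂(γ) - 1`.
[cite: Castella2018, Thm. 3.1] -/
theorem IsBDPLFunctionUpTo.hasValueAt (hL : IsBDPLFunctionUpTo C ι 𝔭 κ γ f ΩK Ωp L)
    {φ : HeckeCharacter K} {n : ℕ} (hn : 0 < n)
    (hunr : ∀ v : HeightOneSpectrum (𝓞 K), φ.IsUnramifiedAt v)
    (hinf : φ.HasInfinityType (fun _ ↦ (n : ℤ)) (fun _ ↦ -(n : ℤ)))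
    {r : FramedGaloisRep K (PadicAlgCl p) 1} (hr : IsPAdicAvatarOf ι φ r)
    (hκ : FactorsThroughZp κ r) :
    L.HasValueAt (avatarValueAt r γ - 1)
      (C * (((ι.symm (bdpInterpolationValue p f 𝔭 φ n ΩK) : PadicAlgCl p) : ℂ_[p]) *
        Ωp ^ (4 * n))) :=
  hL φ n hn hunr hinf r hr hκ

/-- The prescribed value at a character in the range of interpolation is unique: any `v` with
`L.HasValueAt (φ̂(γ) - 1) v` is `C` times Castella's right-hand side. [cite: Castella2018, Thm. 3.1] -/
theorem IsBDPLFunctionUpTo.eq_of_hasValueAt (hL : IsBDPLFunctionUpTo C ι 𝔭 κ γ f ΩK Ωp L)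
    {φ : HeckeCharacter K} {n : ℕ} (hn : 0 < n)
    (hunr : ∀ v : HeightOneSpectrum (𝓞 K), φ.IsUnramifiedAt v)
    (hinf : φ.HasInfinityType (fun _ ↦ (n : ℤ)) (fun _ ↦ -(n : ℤ)))
    {r : FramedGaloisRep K (PadicAlgCl p) 1} (hr : IsPAdicAvatarOf ι φ r)
    (hκ : FactorsThroughZp κ r) {v : ℂ_[p]} (hv : L.HasValueAt (avatarValueAt r γ - 1) v) :
    v = C * (((ι.symm (bdpInterpolationValue p f 𝔭 φ n ΩK) : PadicAlgCl p) : ℂ_[p]) *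
      Ωp ^ (4 * n)) :=
  hv.unique (hL.hasValueAt hn hunr hinf hr hκ)

end InterpolationUpTo

end Literature.NumberTheory.EllipticCurves

end
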